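import Mathlib.Algebra.Homology.HomologicalComplexAbelian
import Literature.Algebra.Homology.StaircaseComplexes
import HarnessLib

/-!
# Exactness of the three-term sequences of staircase image subcomplexes

Continuation of `Algebra/Homology/StaircaseComplexes`. For an abelian category `𝒜`, a complex
`K : CochainComplex 𝒜 ℕ`, `q : ℤ` and antitone exponent functions `a ≤ b ≤ c` (pointwise), put
`Q_c = K / q^{c}` and `Q_b = K / q^{b}` (`powQuotient`) with the reduction `ρ : Q_c ⟶ Q_b`
(`powQuotientMap`). The three-term sequence of staircase images

`0 ⟶ q^{b} Q_c ⟶ q^{a} Q_c ⟶ q^{a} Q_b ⟶ 0`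

(inclusion `powImageLE`, push-forward `powImageMap ρ`) is a SHORT EXACT sequence of complexes
(`staircase_shortExact`) — with NO torsion-freeness hypothesis on `K` (torsion-freeness is only
needed to identify the terms, e.g. `q^{a}(T/q^{c}) ≅ T/q^{c-a}`). Degreewise (`staircase_shortExact_f`)
this is: `ρʲ : Tʲ/q^{c j} → Tʲ/q^{b j}` is a cokernel of multiplication by `q^{b j}`
(`isColimitCokernelCoforkPowQuotientMap`), so its kernel is the image of `q^{b j}`, and the abstract
lemma `exact_of_fac_of_exact` restricts this exactness to the images of `q^{a j}`.

Application (sequel in `AlgebraicGeometry/Crystalline/HuComplexes`): X. Hu's three-term short exact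
sequences `0 → p^{r,M}_{r,N}Ω• → p^{r,M'}_{r,N}Ω• → p^{r,M'}_{r,M}Ω• → 0` for `M' ≤ M ≤ N`
(arXiv:2507.12458, §8), whence long exact sequences in hypercohomology. [folklore]
Everything is proved; no named facts.
-/

noncomputable section

namespace Literature.Algebra.Homology

open CategoryTheory CategoryTheory.Limits

universe v u

variable {𝒜 : Type u} [Category.{v} 𝒜] [Abelian 𝒜]

/-! ### An abstract restriction-of-exactness lemma -/

/-- Let `S₁ ⟶ S₂` (`g`) and `S₂ ⟶ S₃` (`h`) sit over `Q' ⟶ Q''` (`ρ`) through monomorphisms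
`ι₁ = g ≫ ι₂`, `ι₂`, `ι₃` with `h ≫ ι₃ = ι₂ ≫ ρ`. If `S₁ ⟶ Q' ⟶ Q''` is exact then so is
`S₁ ⟶ S₂ ⟶ S₃` ("the kernel of `ρ` restricted to the subobject `S₂` is `S₁`"). [folklore] -/
theorem exact_of_fac_of_exact {S₁ S₂ S₃ Q' Q'' : 𝒜} {g : S₁ ⟶ S₂} {h : S₂ ⟶ S₃} {ι₁ : S₁ ⟶ Q'}
    {ι₂ : S₂ ⟶ Q'} {ι₃ : S₃ ⟶ Q''} {ρ : Q' ⟶ Q''} [Mono ι₁] [Mono ι₂] [Mono ι₃]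
    (hg : g ≫ ι₂ = ι₁) (hh : h ≫ ι₃ = ι₂ ≫ ρ) (w : ι₁ ≫ ρ = 0)
    (hex : (ShortComplex.mk ι₁ ρ w).Exact) (w' : g ≫ h = 0) :
    (ShortComplex.mk g h w').Exact := by
  haveI : Mono g := mono_of_mono_fac hg
  refine ShortComplex.exact_of_f_is_kernel _ (KernelFork.IsLimit.ofι' g w' fun k hk ↦ ?_)
  have hk' : (k ≫ ι₂) ≫ ρ = 0 := by
    rw [Category.assoc, ← hh, ← Category.assoc, hk, zero_comp]
  refine ⟨hex.lift (k ≫ ι₂) hk', ?_⟩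
  rw [← cancel_mono ι₂, Category.assoc, hg]
  exact hex.lift_f (k ≫ ι₂) hk'

/-- In the situation of `exact_of_fac_of_exact`, the composite `g ≫ h` vanishes as soon as
`ι₁ ≫ ρ = 0`. [folklore] -/
theorem comp_eq_zero_of_fac {S₁ S₂ S₃ Q' Q'' : 𝒜} {g : S₁ ⟶ S₂} {h : S₂ ⟶ S₃} {ι₁ : S₁ ⟶ Q'}
    {ι₂ : S₂ ⟶ Q'} {ι₃ : S₃ ⟶ Q''} {ρ : Q' ⟶ Q''} [Mono ι₃]
    (hg : g ≫ ι₂ = ι₁) (hh : h ≫ ι₃ = ι₂ ≫ ρ) (w : ι₁ ≫ ρ = 0) : g ≫ h = 0 := by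
  rw [← cancel_mono ι₃, Category.assoc, hh, ← Category.assoc, hg, w, zero_comp]

/-! ### The reduction map is a cokernel of multiplication by `q ^ b j` -/

section

variable (K : CochainComplex 𝒜 ℕ) (q : ℤ) {b c : ℕ → ℕ} (hb : Antitone b) (hc : Antitone c)
  (hbc : b ≤ c)

/-- `q^{b j} ≫ ρʲ = 0` for the reduction `ρ : K/q^{c} ⟶ K/q^{b}`. [folklore] -/
@[reassoc]
theorem powSMul_comp_powQuotientMap_f (j : ℕ) :
    powSMul (powQuotient K q hc) q b j ≫ (powQuotientMap K q hb hc hbc).f j = 0 := by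
  rw [← cancel_epi (cokernel.π (powSMul K q c j)), comp_zero, ← Category.assoc,
    ← powQuotientπ_f K q hc, ← powSMul_comp q b (powQuotientπ K q hc) j, Category.assoc,
    powQuotientπ_f, π_comp_powQuotientMap_f]
  exact cokernel.condition _

/-- The reduction `ρʲ` is an epimorphism. [folklore] -/
instance epi_powQuotientMap_f (j : ℕ) : Epi ((powQuotientMap K q hb hc hbc).f j) :=
  epi_of_epi_fac (π_comp_powQuotientMap_f K q hb hc hbc j)

/-- **`ρʲ : Kʲ/q^{c j} ⟶ Kʲ/q^{b j}` is a cokernel of multiplication by `q^{b j}` on `Kʲ/q^{c j}`**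
(third isomorphism theorem: `(T/q^{c})/(q^{b}T/q^{c}T) ≅ T/q^{b}` for `b ≤ c`). [folklore] -/
def isColimitCokernelCoforkPowQuotientMap (j : ℕ) :
    IsColimit (CokernelCofork.ofπ ((powQuotientMap K q hb hc hbc).f j)
      (powSMul_comp_powQuotientMap_f K q hb hc hbc j)) :=
  CokernelCofork.IsColimit.ofπ' _ _ fun k hk ↦
    ⟨cokernel.desc _ (cokernel.π (powSMul K q c j) ≫ k) (by
        rw [← Category.assoc, ← powQuotientπ_f K q hc, powSMul_comp q b (powQuotientπ K q hc) j,
          Category.assoc, hk, comp_zero]), by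
      rw [← cancel_epi (cokernel.π (powSMul K q c j)), π_comp_powQuotientMap_f_assoc,
        cokernel.π_desc]⟩

/-- The sequence `Kʲ/q^{c j} →(q^{b j}) Kʲ/q^{c j} →(ρʲ) Kʲ/q^{b j}` is exact. [folklore] -/
theorem exact_powSMul_powQuotientMap_f (j : ℕ) :
    (ShortComplex.mk (powSMul (powQuotient K q hc) q b j) ((powQuotientMap K q hb hc hbc).f j)
      (powSMul_comp_powQuotientMap_f K q hb hc hbc j)).Exact :=
  ShortComplex.exact_of_g_is_cokernel _ (isColimitCokernelCoforkPowQuotientMap K q hb hc hbc j)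

/-- `ι ≫ ρʲ = 0` for the inclusion `ι` of the staircase image `q^{b j}(Kʲ/q^{c j})`. [folklore] -/
@[reassoc]
theorem imageι_comp_powQuotientMap_f (j : ℕ) :
    image.ι (powSMul (powQuotient K q hc) q b j) ≫ (powQuotientMap K q hb hc hbc).f j = 0 := by
  rw [← cancel_epi (factorThruImage (powSMul (powQuotient K q hc) q b j)), image.fac_assoc,
    comp_zero, powSMul_comp_powQuotientMap_f]

/-- The sequence `q^{b j}(Kʲ/q^{c j}) ↪ Kʲ/q^{c j} →(ρʲ) Kʲ/q^{b j}` is exact: the kernel of the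
reduction is the staircase image. [folklore] -/
theorem exact_imageι_powQuotientMap_f (j : ℕ) :
    (ShortComplex.mk (image.ι (powSMul (powQuotient K q hc) q b j))
      ((powQuotientMap K q hb hc hbc).f j) (imageι_comp_powQuotientMap_f K q hb hc hbc j)).Exact := by
  let S₁ : ShortComplex 𝒜 := ShortComplex.mk (powSMul (powQuotient K q hc) q b j)
    ((powQuotientMap K q hb hc hbc).f j) (powSMul_comp_powQuotientMap_f K q hb hc hbc j)
  let S₂ : ShortComplex 𝒜 := ShortComplex.mk (image.ι (powSMul (powQuotient K q hc) q b j))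
    ((powQuotientMap K q hb hc hbc).f j) (imageι_comp_powQuotientMap_f K q hb hc hbc j)
  let φ : S₁ ⟶ S₂ :=
    { τ₁ := factorThruImage (powSMul (powQuotient K q hc) q b j)
      τ₂ := 𝟙 _
      τ₃ := 𝟙 _
      comm₁₂ := by
        change factorThruImage _ ≫ image.ι _ = powSMul (powQuotient K q hc) q b j ≫ 𝟙 _
        rw [image.fac, Category.comp_id]
      comm₂₃ := by
        change 𝟙 _ ≫ (powQuotientMap K q hb hc hbc).f j = (powQuotientMap K q hb hc hbc).f j ≫ 𝟙 _
        rw [Category.id_comp, Category.comp_id] }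
  haveI : Epi φ.τ₁ := by change Epi (factorThruImage _); infer_instance
  haveI : IsIso φ.τ₂ := by change IsIso (𝟙 _); infer_instance
  haveI : Mono φ.τ₃ := by change Mono (𝟙 _); infer_instance
  exact (ShortComplex.exact_iff_of_epi_of_isIso_of_mono φ).mp
    (exact_powSMul_powQuotientMap_f K q hb hc hbc j)

end

/-! ### The short exact sequence of staircase images -/

section

variable (K : CochainComplex 𝒜 ℕ) (q : ℤ) {a b c : ℕ → ℕ} (ha : Antitone a) (hb : Antitone b)
  (hc : Antitone c) (hab : a ≤ b) (hbc : b ≤ c)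

/-- The composite `q^{b}(K/q^{c}) ⟶ q^{a}(K/q^{c}) ⟶ q^{a}(K/q^{b})` vanishes. [folklore] -/
theorem powImageLE_comp_powImageMap :
    powImageLE (powQuotient K q hc) q ha hb hab ≫
      powImageMap (powQuotient K q hc) q ha (powQuotientMap K q hb hc hbc) = 0 := by
  refine HomologicalComplex.hom_ext _ _ fun j ↦ ?_
  rw [HomologicalComplex.comp_f, HomologicalComplex.zero_f, powImageLE_f, powImageMap_f]
  exact comp_eq_zero_of_fac (powImageLEf_ι _ q hab j) (powImageMapf_ι _ q _ j)
    (imageι_comp_powQuotientMap_f K q hb hc hbc j)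

/-- `factorThruImage ≫ (push-forward on images) = φʲ ≫ factorThruImage` (Mathlib's
`image.factor_map`, restated with plain types). [folklore] -/
@[reassoc]
theorem factorThruImage_comp_powImageMapf {Q Q' : CochainComplex 𝒜 ℕ} {e : ℕ → ℕ} (φ : Q ⟶ Q')
    (j : ℕ) :
    factorThruImage (powSMul Q q e j) ≫ powImageMapf Q q φ j =
      φ.f j ≫ factorThruImage (powSMul Q' q e j) :=
  image.factor_map (Arrow.homMk' (φ.f j) (φ.f j) (powSMul_comp q e φ j).symm)

/-- **The three-term sequence of staircase images** `q^{b}(K/q^{c}) ⟶ q^{a}(K/q^{c}) ⟶ q^{a}(K/q^{b})`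
for antitone `a ≤ b ≤ c`, as a short complex of cochain complexes (X. Hu's
`p^{r,M}_{r,N}Ω• → p^{r,M'}_{r,N}Ω• → p^{r,M'}_{r,M}Ω•` for `a, b, c = (r-•)M', (r-•)M, (r-•)N`).
[folklore] -/
def staircaseShortComplex : ShortComplex (CochainComplex 𝒜 ℕ) :=
  ShortComplex.mk _ _ (powImageLE_comp_powImageMap K q ha hb hc hab hbc)

/-- Degreewise, the three-term sequence of staircase images is short exact. [folklore] -/
theorem staircase_shortExact_f (j : ℕ) :
    ((staircaseShortComplex K q ha hb hc hab hbc).map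
      (HomologicalComplex.eval 𝒜 (ComplexShape.up ℕ) j)).ShortExact where
  mono_f := by
    change Mono (powImageLEf (powQuotient K q hc) q hab j)
    exact mono_of_mono_fac (powImageLEf_ι _ q hab j)
  epi_g := by
    change Epi (powImageMapf (powQuotient K q hc) q (powQuotientMap K q hb hc hbc) j)
    haveI : Epi (factorThruImage (powSMul (powQuotient K q hc) q a j) ≫
        powImageMapf (powQuotient K q hc) q (powQuotientMap K q hb hc hbc) j) := by
      rw [factorThruImage_comp_powImageMapf]
      exact epi_comp _ _
    exact epi_of_epi (factorThruImage (powSMul (powQuotient K q hc) q a j)) _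
  exact := exact_of_fac_of_exact (powImageLEf_ι _ q hab j) (powImageMapf_ι _ q _ j)
    (imageι_comp_powQuotientMap_f K q hb hc hbc j) (exact_imageι_powQuotientMap_f K q hb hc hbc j)
    _

/-- **Short exactness of the three-term sequence of staircase images**
`0 ⟶ q^{b}(K/q^{c}) ⟶ q^{a}(K/q^{c}) ⟶ q^{a}(K/q^{b}) ⟶ 0` (antitone `a ≤ b ≤ c`; no torsion
hypothesis on `K`). [folklore] -/
theorem staircase_shortExact : (staircaseShortComplex K q ha hb hc hab hbc).ShortExact :=
  HomologicalComplex.shortExact_of_degreewise_shortExact _ (staircase_shortExact_f K q ha hb hc hab hbc)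

end

end Literature.Algebra.Homology

end
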